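import Mathlib
import HarnessLib
import Summits.CriticalPhenomena.SAWScalingLimit.Theses.SAWDefectDecoherence

/-!
# Ideator3Sketch — crux-ideate stmt-CriticalPhenomena-8536 (BoundaryClosure), ideator 3, round 1

First-lemma signatures for the two idea cards
`Ideas/three-eighths-cup-harnack.md` and `Ideas/two-root-quotient.md`.
Nothing here is proved; every `def … : Prop` must elaborate over existing declarations.
-/

namespace Summit.CriticalPhenomena.SAWScalingLimit.Cruxes.BoundaryClosure.Ideator3Sketch

open scoped BigOperators ComplexConjugate
open Filter Set MeasureTheory
open Literature.Probability.LatticeModels Literature.Probability.RandomPlanarGeometry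
open Literature.Probability.RandomPlanarGeometry.SAW
open Summit.CriticalPhenomena.SAWScalingLimit.Theses.SAWDefectDecoherence

/-- CARD three-eighths-cup-harnack, exact lattice lemma (the "3/8 law" of boundary increments of the
primitive): for a simply connected hexagonal domain `Λ`, boundary root `a = {u,w}` (`u ∉ Λ ∋ w`) and any
OTHER boundary mid-edge `e = {u',w'}` (`u' ∉ Λ ∋ w'`), the boundary increment of the primitive,
`ι(e) := (mid e − c_{w'}) · F_{x_c,5/8}(e)`, is a POSITIVE multiple of `unit(c_w − c_u) · e^{i(3/8)W}` where
`W` is the (rigid) winding of any walk `a → e`: the outward normal at `e` is the inward direction at `a`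
turned by `W`, and the weight carries `e^{-i(5/8)W}`, so the increment turns at `1 − 5/8 = 3/8` of the
rate of the boundary normal.  Consequence used by the card: along `∂Λ ∖ {a}` all increments have
argument in an arc of length `(3/8)·(range of W) = 3π/4 < π` whenever `|W| ≤ π` (tame boundary), so the
image polygon of `∂Λ ∖ {a}` under the primitive is a monotone Lipschitz graph over the axis `unit(c_w−c_u)`
and is closed by the root chord `ι(a) = −(1/2)(c_w − c_u)`. -/
def BoundaryIncrementPhase : Prop :=
  ∀ (Λ : Finset HexVertex), hexDomainSimplyConnected Λ →
    ∀ (u w : HexVertex), hexGraph.Adj u w → u ∉ Λ → w ∈ Λ →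
    ∀ (u' w' : HexVertex), hexGraph.Adj u' w' → u' ∉ Λ → w' ∈ Λ → s(u', w') ≠ s(u, w) →
    ∀ γ : HexMidEdgeSAW Λ s(u, w) s(u', w'),
      (hexMidpoint s(u', w') - hexCenter w') *
          hexParafermionicObservable Λ s(u, w) hexCriticalFugacity (5 / 8) s(u', w') =
        ((‖hexMidpoint s(u', w') - hexCenter w'‖ *
            ‖hexParafermionicObservable Λ s(u, w) hexCriticalFugacity 0 s(u', w')‖ : ℝ) : ℂ) *
          ((hexCenter w - hexCenter u) / (‖hexCenter w - hexCenter u‖ : ℂ)) *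
          Complex.exp (Complex.I * (3 / 8 : ℂ) * (γ.winding : ℂ))

/-- CARD three-eighths-cup-harnack, the load-bearing intermediate (interior L²-Harnack = the
compactness / maximum-principle substitute the crux lacks): in the setting of `MassRatio`
(Dobrushin domain flat near `b`, admissible simply connected discretisation family, boundary
mid-edges `a_δ → a`, `b_δ → b`), for every compact `K ⊂ Ω` there is `C` with
`δ² Σ_{e : δ·mid e ∈ K} |F_δ(e)|² ≤ C |F_δ(b_δ)|²` eventually as `δ → 0+`, `F_δ = F_{x_c,5/8}` rooted at
`a_δ`.  The card derives it from `DefectDecoherence` (θ > 3/4) and `MassRatio` (cut 3/4) through the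
degree-one cup: PL area formula with cut-offs in the IMAGE plane + the finite-distortion modulus
inequality; the only exponent arithmetic is `2θ − 3/2 > 0`. -/
def InteriorL2Harnack : Prop :=
  ∀ (D : DobrushinDomain) (ρ : ℝ) (Λ : ℝ → Finset HexVertex) (m : ℝ → ℤ)
    (a b : ℝ → Sym2 HexVertex),
    let F : ℝ → Sym2 HexVertex → ℂ := fun δ z =>
      hexParafermionicObservable (Λ δ) (a δ) hexCriticalFugacity (5 / 8) z
    0 < ρ → D.carrier ∩ Metric.ball (D.pt 1) ρ = {z : ℂ | (D.pt 1).im < z.im} ∩ Metric.ball (D.pt 1) ρ →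
    (∀ᶠ δ : ℝ in nhdsWithin 0 (Set.Ioi 0), hexDomainSimplyConnected (Λ δ) ∧
        a δ ∈ hexDomainBoundary (Λ δ) ∧ b δ ∈ hexDomainBoundary (Λ δ) ∧
        Nonempty (HexMidEdgeSAW (Λ δ) (a δ) (b δ)) ∧
        (hexGraph.induce ((Λ δ : Finset HexVertex) : Set HexVertex)).Preconnected ∧
        (∀ v ∈ Λ δ, (δ : ℂ) * hexCenter v ∈ D.carrier) ∧
        (∀ v : HexVertex, (δ : ℂ) * hexCenter v ∈ Metric.ball (D.pt 1) ρ → (v ∈ Λ δ ↔ m δ ≤ v.1 1))) →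
    (∀ K : Set ℂ, IsCompact K → K ⊆ D.carrier → ∀ᶠ δ : ℝ in nhdsWithin 0 (Set.Ioi 0),
        ∀ v : HexVertex, (δ : ℂ) * hexCenter v ∈ K → v ∈ Λ δ) →
    Tendsto (fun δ : ℝ => (δ : ℂ) * hexMidpoint (a δ)) (nhdsWithin 0 (Set.Ioi 0)) (nhds (D.pt 0)) →
    Tendsto (fun δ : ℝ => (δ : ℂ) * hexMidpoint (b δ)) (nhdsWithin 0 (Set.Ioi 0)) (nhds (D.pt 1)) →
    ∀ K : Set ℂ, IsCompact K → K ⊆ D.carrier → ∃ C : ℝ, ∀ᶠ δ : ℝ in nhdsWithin 0 (Set.Ioi 0),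
      δ ^ 2 * (∑ᶠ e ∈ {e : Sym2 HexVertex | e ∈ hexDomainMidEdges (Λ δ) ∧
          (δ : ℂ) * hexMidpoint e ∈ K}, ‖F δ e‖ ^ 2) ≤ C * ‖F δ (b δ)‖ ^ 2

/-- The first stub of the three-eighths-cup line, as an implication over the crux's own hypotheses. -/
def CupHarnackStep : Prop := DefectDecoherence → MassRatio → InteriorL2Harnack

/-- CARD two-root-quotient, exact lattice lemma (arc-constancy of the two-root phase): for a simply
connected `Λ`, two boundary roots `a = {u₁,w₁}`, `a' = {u₂,w₂}` and two further boundary mid-edges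
`e = {u₃,w₃}`, `e' = {u₄,w₄}` (all four distinct), the difference of rigid windings
`W_a(e) − W_{a'}(e)` changes, from `e` to `e'`, by `0` or `±2π` only: it is constant on each of the two
boundary arcs cut out by `a, a'` and jumps by `2π` across `a'` (by `−2π` across `a`).  Hence the quotient
`F_a(e) / F_{a'}(e) = (Z_a(e)/Z_{a'}(e)) · e^{-i(5/8)(W_a(e) − W_{a'}(e))}` has lattice-factor-free modulus
and PIECEWISE CONSTANT phase (two values differing by `e^{∓ 5πi/4}`) on every boundary, however rough. -/
def TwoRootArcConstancy : Prop :=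
  ∀ (Λ : Finset HexVertex), hexDomainSimplyConnected Λ →
    ∀ (u₁ w₁ u₂ w₂ u₃ w₃ u₄ w₄ : HexVertex),
      hexGraph.Adj u₁ w₁ → u₁ ∉ Λ → w₁ ∈ Λ → hexGraph.Adj u₂ w₂ → u₂ ∉ Λ → w₂ ∈ Λ →
      hexGraph.Adj u₃ w₃ → u₃ ∉ Λ → w₃ ∈ Λ → hexGraph.Adj u₄ w₄ → u₄ ∉ Λ → w₄ ∈ Λ →
      List.Pairwise (· ≠ ·) [s(u₁, w₁), s(u₂, w₂), s(u₃, w₃), s(u₄, w₄)] →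
    ∀ (γ₁ : HexMidEdgeSAW Λ s(u₁, w₁) s(u₃, w₃)) (γ₂ : HexMidEdgeSAW Λ s(u₂, w₂) s(u₃, w₃))
      (γ₃ : HexMidEdgeSAW Λ s(u₁, w₁) s(u₄, w₄)) (γ₄ : HexMidEdgeSAW Λ s(u₂, w₂) s(u₄, w₄)),
      ∃ k : ℤ, (k = 0 ∨ k = 1 ∨ k = -1) ∧
        (γ₁.winding - γ₂.winding) - (γ₃.winding - γ₄.winding) = 2 * Real.pi * k

/-- CARD two-root-quotient, the limit statement it feeds into the crux (root-ratio law, weak form):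
for two admissible root families `a_δ → a = D.pt 0` and `a'_δ → a'` (a third boundary point with
`Φ(a') = t ≠ 0` real under the chart `Φ : Ω → ℍ`, `a ↦ ∞`, `b ↦ 0`), the normalised observables differ in
the limit exactly by the factor `(1 − Φ/t)^{5/4}`: tested against `ψ ∈ C_c(Ω)`,
`δ²⟨ψ, F^{a'}_δ⟩/F^{a'}_δ(b_δ) − δ²⟨ψ·(1 − Φ/t)^{5/4}, F^{a}_δ⟩/F^{a}_δ(b_δ) → 0`.
(Stated here only over the chart `Φ`; it is implied by `HexObservableLimit` for both roots and, with the
crux's hypotheses for ONE root plus the card's quotient Riemann–Hilbert argument, implies it for all.) -/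
def RootRatioLaw : Prop :=
  ∀ (D : DobrushinDomain) (ρ : ℝ) (Λ : ℝ → Finset HexVertex) (m : ℝ → ℤ)
    (a a' b : ℝ → Sym2 HexVertex) (Φ : ConformalEquiv D.carrier UpperHalfPlane.upperHalfPlaneSet)
    (t : ℝ) (ψ : ℂ → ℂ),
    let F : ℝ → Sym2 HexVertex → ℂ := fun δ z =>
      hexParafermionicObservable (Λ δ) (a δ) hexCriticalFugacity (5 / 8) z
    let F' : ℝ → Sym2 HexVertex → ℂ := fun δ z =>
      hexParafermionicObservable (Λ δ) (a' δ) hexCriticalFugacity (5 / 8) z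
    0 < ρ → t ≠ 0 →
    D.carrier ∩ Metric.ball (D.pt 1) ρ = {z : ℂ | (D.pt 1).im < z.im} ∩ Metric.ball (D.pt 1) ρ →
    (∀ᶠ δ : ℝ in nhdsWithin 0 (Set.Ioi 0), hexDomainSimplyConnected (Λ δ) ∧
        a δ ∈ hexDomainBoundary (Λ δ) ∧ a' δ ∈ hexDomainBoundary (Λ δ) ∧ b δ ∈ hexDomainBoundary (Λ δ) ∧
        Nonempty (HexMidEdgeSAW (Λ δ) (a δ) (b δ)) ∧
        (hexGraph.induce ((Λ δ : Finset HexVertex) : Set HexVertex)).Preconnected ∧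
        (∀ v ∈ Λ δ, (δ : ℂ) * hexCenter v ∈ D.carrier) ∧
        (∀ v : HexVertex, (δ : ℂ) * hexCenter v ∈ Metric.ball (D.pt 1) ρ → (v ∈ Λ δ ↔ m δ ≤ v.1 1))) →
    (∀ K : Set ℂ, IsCompact K → K ⊆ D.carrier → ∀ᶠ δ : ℝ in nhdsWithin 0 (Set.Ioi 0),
        ∀ v : HexVertex, (δ : ℂ) * hexCenter v ∈ K → v ∈ Λ δ) →
    Tendsto (fun δ : ℝ => (δ : ℂ) * hexMidpoint (a δ)) (nhdsWithin 0 (Set.Ioi 0)) (nhds (D.pt 0)) →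
    Tendsto (fun δ : ℝ => (δ : ℂ) * hexMidpoint (b δ)) (nhdsWithin 0 (Set.Ioi 0)) (nhds (D.pt 1)) →
    Tendsto (fun x => ‖Φ x‖) (nhdsWithin (D.pt 0) D.carrier) atTop →
    Φ.HasBoundaryValue (D.pt 1) 0 →
    (∃ aInf : ℂ, aInf ∈ frontier D.carrier ∧
      Tendsto (fun δ : ℝ => (δ : ℂ) * hexMidpoint (a' δ)) (nhdsWithin 0 (Set.Ioi 0)) (nhds aInf) ∧
      Φ.HasBoundaryValue aInf t) →
    Continuous ψ → HasCompactSupport ψ → tsupport ψ ⊆ D.carrier →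
    Tendsto (fun δ : ℝ =>
        (δ : ℂ) ^ 2 * (∑ᶠ e ∈ hexDomainMidEdges (Λ δ), ψ ((δ : ℂ) * hexMidpoint e) * F' δ e) / F' δ (b δ) -
        (δ : ℂ) ^ 2 * (∑ᶠ e ∈ hexDomainMidEdges (Λ δ),
            ψ ((δ : ℂ) * hexMidpoint e) * ((1 : ℂ) - (Φ ((δ : ℂ) * hexMidpoint e) : ℂ) / t) ^ ((5 : ℂ) / 4) *
              F δ e) / F δ (b δ))
      (nhdsWithin 0 (Set.Ioi 0)) (nhds 0)

end Summit.CriticalPhenomena.SAWScalingLimit.Cruxes.BoundaryClosure.Ideator3Sketch
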